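import Summits.QuantumFields.YangMills.Theorems.BalabanUVNodesK0Beta13RadiusBlindFirstForm
import Summits.QuantumFields.YangMills.Theorems.BalabanUVNodesK0V23Defs

/-!
# K0⁷ — THE DOOR «2′ ⟸ A |β|-BOX AT ONE FIXED BACKGROUND RADIUS ā + THE RESTRICTION ROWS» (director-ym №432's node shape, kernel form: (W₁) ∧ (T) two-sided ⟹ the V23 stub text BY NAME)

Cell `pub-ymgap`, width seat `pub-ymgap-dag-n07-w3` (g19; N07 [B11] ∕ K0⁷ junction).  `--kind proof --supports stmt-QuantumFields-20541 --as helper`, COUNT-NEUTRAL.  NEW leaf;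
theorems only — 0 `def`, 0 `sorry`, 0 `instance`, 0 `notation`.  Imports this seat's `…K0Beta13RadiusBlindFirstForm` (✓p788772: radius blindness by RESTRICTION, selector row free
downward ∕ one (8)-row upward) and `…K0V23Defs` (the V23 text; route-independent — `…K0V23Stub3Sockets`' iff ∕ census are re-derived inline, both `rfl`-level, to stay out of
the Theses cone).  [I] = [Balaban1987RG1]; [15] = [Balaban1985Variational].

WHY.  After №431 ((T2) ↦ (T2″)), №432 (node of record «2′ ⟸ (W₁) ∧ (T) two-sided»), №437 (guard print-faithful) and this seat's erratum (the CLASS-BOUND instantiation is idle; RESTRICTION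
is the mechanism), the node that removes the `∀ a₀` of the V23 stub-3ᴬ′ᴮ text reads: a producer delivers, for every radius `a₀ > 0` carrying the [15] antecedents, ONE sign-free box of
`β₁₃(F; ā, ε₂₉)` at a FIXED background radius `ā` and a (2.9)-threshold `ε₂₉` of its choosing (cofinally small: (W₁)), together with the first-form rows of `…RadiusBlindFirstForm` for the
pair `(ā, a₀)` at that `ε₂₉` — the selector row being FREE when `a₀ ≤ ā` (with the domain's regularity `ρ ≤ a₀`) and ONE (8)-shaped row when `ā ≤ a₀`.  THIS FILE is that door, BY NAME
onto `K0V23Defs.AbsBetaBoxAtThm1WitnessCCMGenGridGZBAt F`: ★★ `absBetaBoxGZBAt_of_boxAtRadius_of_firstFormRows`.  The antecedents are passed to the producer (it may read them to pay the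
(8)-row); the box is read at the member `(j, ε₀, B₃, B₃′, a₁, Efl, logz) = 0` and moved to every member by the letter census (`betaOfRecord₁₃_zbRegime_letterBlind`, `rfl`).

HONEST FRAMING (binding).  A composition BY NAME; NO β estimate; nothing of Bałaban's asserted.  Every input is a displayed HYPOTHESIS of the producer's: the box at `ā` IS NODE O's wall
([I] Thm 3 β-clause p.264 at one background radius along cofinal thresholds — print-proved (claimed), UNPORTED); the rows are [15]∕N07-species (restriction (9)–(10), uniqueness (1.1),
Lipschitz-(8) on the (2.9)-collar, (8) upward, first-form domain + its openness) and the row-P7 continuity species; none is discharged here.  This door does NOT register a skeleton (V23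
d01c50abc247f5ff «1∕2 (+2′)» of record) and moves no count.  Stub 2′ OPEN; K0⁷ stmt-QuantumFields-20541 NOT closed; N07 NOT discharged; COUNT 8∕28 · K 1∕4 UNMOVED; R4 = the CONDITIONAL
finite-𝕋⁴ rung `BalabanLadder.UV` at fixed `ε = L^(−K)` only — NOT continuum ∕ ℝ⁴ ∕ OS; the Yang–Mills mass gap (Clay) is NOT proved by any of this.  Standard axioms only.
-/

noncomputable section

open MeasureTheory Set Filter
open scoped Matrix.Norms.L2Operator

namespace Summit.QuantumFields.YangMills.BalabanUVNodes.K0TwoPrimeOfFixedRadiusBox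

open Literature.MathematicalPhysics.QuantumFieldTheory.Balaban1983to89
open Literature.MathematicalPhysics.QuantumFieldTheory.Balaban1983to89.Node00
open Literature.MathematicalPhysics.QuantumFieldTheory.Balaban1983to89.T4Continuum
open Literature.MathematicalPhysics.QuantumFieldTheory.Balaban1983to89.FlowStep
open Literature.MathematicalPhysics.QuantumFieldTheory.Balaban1983to89.B15DeterminingSets
open B12Eq019ActionBody (integrand)
open Summit.QuantumFields.YangMills.Theorems.K0V23Defs (AbsBetaBoxAtThm1WitnessCCMGenGridGZBAt)
open Summit.QuantumFields.YangMills.BalabanUVNodes.K0Beta13RadiusBlindFirstForm (betaOfRecord₁₃_thm1CCMWZB_radiusBlind_firstForm_down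
  betaOfRecord₁₃_thm1CCMWZB_radiusBlind_firstForm_up)

variable (F : T4Family)

/-- ★★ **THE DOOR «2′ ⟸ box at ONE fixed radius + restriction rows».**  Fix `ā`.  Suppose that for every radius `a₀ > 0` at which the V23 text's [15] antecedents are inhabited the producer
gives: `γ₀, ε₂₉ > 0`, `β′`, a regularity `ρ ≥ 0`, an open domain system `U K k ∋ 1` of level-`k` fields, such that (box) `−β′ ≤ β₁₃(F; ā, ε₂₉) ≤ β′` on `]0, γ₀]` at the member
`θ₁₃ᶜᶜᴹᵂᶻᴮ(0; ½; ā; 0, ε₂₉; 0, 0, ā, 0; 0, 0)`; (first-form) `U` IS the domain «radius-`ā` problem solvable and every radius-`ā` minimiser `ρ·η²`-regular»; (restriction) `U_{k+1}(ā; W)` minimises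
at radius `ā` over its own `k`-fold average, with a unique minimal orbit there; (collar) a field over `U_{k+1}` where the `ā`-member's (2.9) cutoff is non-zero lies in `U_k`'s first form;
(continuity) the transforms of the `ā`-member's β-densities are regular on `U_{k+1}`; and (selector) EITHER `a₀ ≤ ā ∧ ρ ≤ a₀` OR `ā ≤ a₀` with the (8)-row «radius-`a₀` problem solvable
on `U_{k+1}` with `ā`-regular minimisers».  THEN `K0V23Defs.AbsBetaBoxAtThm1WitnessCCMGenGridGZBAt F`.  (Radius blindness `…RadiusBlindFirstForm._down ∕ _up` moves the box from `ā` to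
`a₀`; the letter census moves it to every member.) [cite: Balaban1987RG1, Thm 1 p.259, Thm 3 p.264, (1.20)–(1.22) p.264, (1.1)–(1.2) p.260, (2.9) p.266; Balaban1985Variational, Thm 1 (6),(8)–(10) p.279 (bookkeeping)] -/
theorem absBetaBoxGZBAt_of_boxAtRadius_of_firstFormRows (ā : ℝ)
    (h : ∀ a₀ : ℝ, 0 < a₀ →
      (∃ (j c c₀ c₁ : ℕ) (B₃ B₃' a₁ : ℝ), c ≤ F.L ^ j ∧ c₀ ≤ j + 1 ∧ c₁ ≤ j ∧ 2 * (F.L : ℝ) ^ 2 ≤ B₃ ∧ 0 < B₃' ∧ 0 < a₁ ∧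
        VariationalThm1RegSepCoP7MGB F 2
          (fun ν M g K k _s => c ≤ ν.M₁ ∧ k + c₀ ≤ F.m + K ∧ F.L ^ c₁ ∣ M ∧
            ∀ i, 1 ≤ i → i ≤ k → dCubeSide (F.P K).L M (RkOfRecord (F.P K).L ν.r (g i)) i ∣ (F.P K).sitesPerDir 0) (lamDatum F) (dataSmall7LamTopOf F 2) B₃ a₀ a₁ ∧
        Gauge9RegSepTopStepGB F 2 (fun ν K Ω => suppDomOfRecord F ν K Ω) (F.L ^ j)
          (fun ν M g K k _s => c ≤ ν.M₁ ∧ k + c₀ ≤ F.m + K ∧ F.L ^ c₁ ∣ M ∧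
            ∀ i, 1 ≤ i → i ≤ k → dCubeSide (F.P K).L M (RkOfRecord (F.P K).L ν.r (g i)) i ∣ (F.P K).sitesPerDir 0) (lamDatum F) (dataSmall7LamTopOf F 2) B₃ B₃' a₀ a₁) →
      ∃ (γ₀ ε₂₉ β' ρ : ℝ) (U : (K k : ℕ) → Set (GaugeField (F.P K) k (Node00.SU 2))),
        0 < γ₀ ∧ 0 < ε₂₉ ∧ 0 ≤ ρ ∧
        BetaLowerH (-β') γ₀ (betaOfRecord₁₃ F 2 (theta13OfThm1CCMWZB F 2 0 (1 / 2) ā 0 ε₂₉ 0 0 ā 0 (fun _ _ => 0) (fun _ _ => 0))) ∧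
        BetaUpperH β' γ₀ (betaOfRecord₁₃ F 2 (theta13OfThm1CCMWZB F 2 0 (1 / 2) ā 0 ε₂₉ 0 0 ā 0 (fun _ _ => 0) (fun _ _ => 0))) ∧
        (∀ K k, IsOpen (U K k)) ∧ (∀ K k, (1 : GaugeField (F.P K) k (Node00.SU 2)) ∈ U K k) ∧
        (∀ K k V, V ∈ U K k → UkExists F 2 K k ā V ∧ ∀ U₁, IsBackground (avOfRecord F 2 K) (bgReg F 2 K k ā) k V U₁ → U₁ ∈ bgReg F 2 K k ρ) ∧
        (∀ K k V, UkExists F 2 K k ā V → (∀ U₁, IsBackground (avOfRecord F 2 K) (bgReg F 2 K k ā) k V U₁ → U₁ ∈ bgReg F 2 K k ρ) → V ∈ U K k) ∧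
        (∀ K k W, k < K → W ∈ U K (k + 1) →
          IsBackground (avOfRecord F 2 K) (bgReg F 2 K k ā) k (Averaging.iter (avOfRecord F 2 K) k (Uk F 2 K (k + 1) ā W)) (Uk F 2 K (k + 1) ā W)) ∧
        (∀ K k W, k < K → W ∈ U K (k + 1) → UniqueUkOrbit F 2 K k ā (Averaging.iter (avOfRecord F 2 K) k (Uk F 2 K (k + 1) ā W))) ∧
        (∀ K k V, k < K → (avOfRecord F 2 K k).avg V ∈ U K (k + 1) → chiFix29OfRecord F 2 (numerics7OfThm1CCM F.L 0 0 0 0 ā 0) ε₂₉ K k V ≠ 0 →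
          UkExists F 2 K k ā V ∧ ∀ U₁, IsBackground (avOfRecord F 2 K) (bgReg F 2 K k ā) k V U₁ → U₁ ∈ bgReg F 2 K k ρ) ∧
        (∀ K (g : ℕ → ℝ) k, k < K → U K (k + 1) ⊆ regSetOfRecord F 2 K k
          (integrand (chiFixed29 F 2 (numerics7OfThm1CCM F.L 0 0 0 0 ā 0) ε₂₉ K g k) (gfOfRecord F 2 K k) (g k)
            (effActionHT F 2 (TcanOfRecord F 2) (chiFixed29 F 2 (numerics7OfThm1CCM F.L 0 0 0 0 ā 0) ε₂₉) K g k))) ∧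
        ((a₀ ≤ ā ∧ ρ ≤ a₀) ∨
          (ā ≤ a₀ ∧ ∀ K k W, k < K → W ∈ U K (k + 1) →
            UkExists F 2 K (k + 1) a₀ W ∧ ∀ U₁, IsBackground (avOfRecord F 2 K) (bgReg F 2 K (k + 1) a₀) (k + 1) W U₁ → U₁ ∈ bgReg F 2 K (k + 1) ā))) :
    AbsBetaBoxAtThm1WitnessCCMGenGridGZBAt F := by
  intro j c c₀ c₁ B₃ B₃' a₀ a₁ hc hc₀ hc₁ hB₃ hB₃' ha₀ ha₁ h15 h9
  obtain ⟨γ₀, ε₂₉, β', ρ, U, hγ₀, hε, hρ, hlo, hup, hUo, hU1, hsub, hsup, hR, hQ, hS, hT, hsel⟩ :=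
    h a₀ ha₀ ⟨j, c, c₀, c₁, B₃, B₃', a₁, hc, hc₀, hc₁, hB₃, hB₃', ha₁, h15, h9⟩
  -- radius blindness ā ↦ a₀ at the zero member, by restriction (selector row free downward, one (8)-row upward)
  have heq : betaOfRecord₁₃ F 2 (theta13OfThm1CCMWZB F 2 0 (1 / 2) ā 0 ε₂₉ 0 0 ā 0 (fun _ _ => 0) (fun _ _ => 0)) =
      betaOfRecord₁₃ F 2 (theta13OfThm1CCMWZB F 2 0 (1 / 2) a₀ 0 ε₂₉ 0 0 a₀ 0 (fun _ _ => 0) (fun _ _ => 0)) := by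
    rcases hsel with ⟨hle, hρa⟩ | ⟨hle, h8⟩
    · exact betaOfRecord₁₃_thm1CCMWZB_radiusBlind_firstForm_down F 2 0 (1 / 2) 0 ε₂₉ 0 0 0 ā a₀ ρ _ _ hρ hρa hle U hUo hU1 hsub hsup hR hQ hS hT
    · exact betaOfRecord₁₃_thm1CCMWZB_radiusBlind_firstForm_up F 2 0 (1 / 2) 0 ε₂₉ 0 0 0 ā a₀ ρ _ _ hρ hle U hUo hU1 hsub hsup hR hQ hS hT h8
  -- the letter census (`rfl`): the member the text names has the β of the zero member of the same radius
  have hcensus : betaOfRecord₁₃ F 2 (theta13OfThm1CCMWZB F 2 j (1 / 2) a₀ a₀ ε₂₉ B₃ B₃' a₀ a₁ (fun _ _ => 0) (fun _ _ => 0)) =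
      betaOfRecord₁₃ F 2 (theta13OfThm1CCMWZB F 2 0 (1 / 2) a₀ 0 ε₂₉ 0 0 a₀ 0 (fun _ _ => 0) (fun _ _ => 0)) := rfl
  refine ⟨γ₀, a₀, ε₂₉, β', hγ₀, ha₀, hε, ?_, ?_⟩
  · rw [hcensus, ← heq]; exact hlo
  · rw [hcensus, ← heq]; exact hup

end Summit.QuantumFields.YangMills.BalabanUVNodes.K0TwoPrimeOfFixedRadiusBox
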